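import Summits.CriticalPhenomena.SAWScalingLimit.Theorems.CriticalBubbleBound.Negative.CriticalBubbleBoundLatticeKernel

/-!
# `CriticalBubbleBound → BoundaryHarnack`: the one-step splitting at the neighbour `b'`

Route `SAWTotalPositivity`, item `stmt-CriticalPhenomena-7120` (`BoundaryHarnack`, support).

For `b' ∼ b` adjacent in `Ω_δ` and any `t`, split a self-avoiding walk `γ : t → b` of `Ω_δ`
according to whether it visits `b'`:

* (A) `b' ∉ γ`: `γ` followed by the edge `b b'` is a SAW `t → b'` of length `|γ| + 1`
  (an injective map), so `Σ_A x_c^{|γ|} ≤ x_c⁻¹ · Z(t,b')`;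
* (B) `b' ∈ γ`: `γ = α · β` with `α : t → b'` (up to the unique visit of `b'`) and `β : b' → b`
  (an injective map into pairs), so `Σ_B x_c^{|γ|} ≤ Z(t,b') · Z(b',b)`.

Hence the hypothesis-free one-step bound `Z(t,b) ≤ (x_c⁻¹ + Z(b',b)) · Z(t,b')` in EVERY discrete
domain (`BoundaryHarnack.weight_le_of_adj`: no planarity, interlacing, realisability or simple
connectivity is used), and the critical bubble bound `Z(b',b) ≤ C_bubble` (`b' ∼ b` are
`ℤ²`-neighbours) gives `BoundaryHarnack` with `C = x_c⁻¹ + C_bubble`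
(`boundaryHarnack_of_criticalBubbleBound`); `x_c > 0` is the elementary
`SAW.criticalFugacity_pos_lt_one'` (`μ(ℤ²) ≥ 2`), and `Z = Σ_γ x_c^{|γ|}` as a `tsum` is the
disprover's `CriticalBubbleBound.Negative.weight_univ`. As a corollary the glue decl `TPToHarnack`
(`BoundaryTP2 → CriticalBubbleBound → BoundaryHarnack`, item stmt-CriticalPhenomena-7121) holds with
its first hypothesis idle (`tpToHarnack_proof`).
-/

noncomputable section

open MeasureTheory Set Function
open Literature.Probability.LatticeModels
open Literature.Probability.RandomPlanarGeometry Literature.Probability.RandomPlanarGeometry.SAW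
open scoped ENNReal

namespace Summit.CriticalPhenomena.SAWScalingLimit.Theorems

open Summit.CriticalPhenomena.SAWScalingLimit.Theses.SAWTotalPositivity
open Summit.CriticalPhenomena.SAWScalingLimit.Theorems.CriticalBubbleBound.Negative (weight_univ)

namespace BoundaryHarnack

variable {Ω : Set ℂ} {δ : ℝ}

/-- `x_c > 0` as an extended nonnegative real. -/
theorem ofReal_criticalFugacity_ne_zero : ENNReal.ofReal criticalFugacity ≠ 0 :=
  (ENNReal.ofReal_pos.mpr criticalFugacity_pos_lt_one'.1).ne'

/-! ### (A) walks avoiding `b'`: extend by the edge `b → b'` -/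

/-- Extending a SAW `t → b` that avoids `b'` by the edge `b b'` is injective (drop the last
edge to invert). -/
theorem concat_injective {t b b' : Site 2} (h : (discreteDomainGraph Ω δ).Adj b b') :
    Injective (fun γ : {γ : DomainSAW Ω δ t b // b' ∉ γ.walk.support} =>
      (⟨γ.1.walk.concat h, γ.1.isPath.concat γ.2 h⟩ : DomainSAW Ω δ t b')) := by
  rintro ⟨⟨p, hp⟩, hp'⟩ ⟨⟨q, hq⟩, hq'⟩ hpq
  have h1 : p.concat h = q.concat h := congrArg DomainSAW.walk hpq
  obtain ⟨hv, h2⟩ := SimpleGraph.Walk.concat_inj h1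
  cases hv
  have h3 : p = q := by simpa using h2
  subst h3
  rfl

/-- (A): `Σ_{γ : t → b, b' ∉ γ} x_c^{|γ|} ≤ x_c⁻¹ · Z(t,b')` — each such `γ` extends by the edge
`b b'` to a SAW `t → b'` of weight `x_c · x_c^{|γ|}`. -/
theorem tsum_avoid_le {t b b' : Site 2} (h : (discreteDomainGraph Ω δ).Adj b b') :
    ∑' γ : {γ : DomainSAW Ω δ t b // b' ∉ γ.walk.support},
        ENNReal.ofReal (criticalFugacity ^ γ.1.length) ≤
      (ENNReal.ofReal criticalFugacity)⁻¹ * SAW.weight Ω δ t b' univ := by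
  rw [weight_univ]
  -- the extension map and its effect on the weight
  set e : {γ : DomainSAW Ω δ t b // b' ∉ γ.walk.support} → DomainSAW Ω δ t b' :=
    fun γ => ⟨γ.1.walk.concat h, γ.1.isPath.concat γ.2 h⟩ with he
  have hwe : ∀ γ : {γ : DomainSAW Ω δ t b // b' ∉ γ.walk.support},
      ENNReal.ofReal (criticalFugacity ^ (e γ).length) =
        ENNReal.ofReal criticalFugacity * ENNReal.ofReal (criticalFugacity ^ γ.1.length) := by
    intro γ
    have hl : (e γ).length = γ.1.length + 1 := SimpleGraph.Walk.length_concat _ _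
    rw [hl, pow_succ, mul_comm, ENNReal.ofReal_mul criticalFugacity_pos_lt_one'.1.le]
  calc ∑' γ : {γ : DomainSAW Ω δ t b // b' ∉ γ.walk.support},
          ENNReal.ofReal (criticalFugacity ^ γ.1.length)
      = ∑' γ : {γ : DomainSAW Ω δ t b // b' ∉ γ.walk.support},
          (ENNReal.ofReal criticalFugacity)⁻¹ * ENNReal.ofReal (criticalFugacity ^ (e γ).length) := by
        congr 1; funext γ
        rw [hwe, ← mul_assoc,
          ENNReal.inv_mul_cancel ofReal_criticalFugacity_ne_zero ENNReal.ofReal_ne_top, one_mul]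
    _ = (ENNReal.ofReal criticalFugacity)⁻¹ *
          ∑' γ : {γ : DomainSAW Ω δ t b // b' ∉ γ.walk.support},
            ENNReal.ofReal (criticalFugacity ^ (e γ).length) :=
        ENNReal.tsum_mul_left
    _ ≤ (ENNReal.ofReal criticalFugacity)⁻¹ *
          ∑' γ' : DomainSAW Ω δ t b', ENNReal.ofReal (criticalFugacity ^ γ'.length) := by
        gcongr
        exact ENNReal.tsum_comp_le_tsum_of_injective (concat_injective h)
          (fun γ' : DomainSAW Ω δ t b' => ENNReal.ofReal (criticalFugacity ^ γ'.length))

/-! ### (B) walks through `b'`: split at the (unique) visit -/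

/-- Splitting a SAW `t → b` through `b'` into its pieces `t → b'` and `b' → b`
(`takeUntil` / `dropUntil`) is injective (append to invert). -/
theorem split_injective {t b b' : Site 2} :
    Injective (fun γ : {γ : DomainSAW Ω δ t b // b' ∈ γ.walk.support} =>
      ((⟨γ.1.walk.takeUntil b' γ.2, γ.1.isPath.takeUntil γ.2⟩,
        ⟨γ.1.walk.dropUntil b' γ.2, γ.1.isPath.dropUntil γ.2⟩) :
          DomainSAW Ω δ t b' × DomainSAW Ω δ b' b)) := by
  intro γ₁ γ₂ h12
  have h1 : (γ₁.1.walk.takeUntil b' γ₁.2).append (γ₁.1.walk.dropUntil b' γ₁.2) = γ₁.1.walk :=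
    SimpleGraph.Walk.take_spec _ _
  have h2 : (γ₂.1.walk.takeUntil b' γ₂.2).append (γ₂.1.walk.dropUntil b' γ₂.2) = γ₂.1.walk :=
    SimpleGraph.Walk.take_spec _ _
  have ha : γ₁.1.walk.takeUntil b' γ₁.2 = γ₂.1.walk.takeUntil b' γ₂.2 :=
    congrArg (fun p : DomainSAW Ω δ t b' × DomainSAW Ω δ b' b => p.1.walk) h12
  have hb : γ₁.1.walk.dropUntil b' γ₁.2 = γ₂.1.walk.dropUntil b' γ₂.2 :=
    congrArg (fun p : DomainSAW Ω δ t b' × DomainSAW Ω δ b' b => p.2.walk) h12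
  rw [ha, hb] at h1
  have hw : γ₁.1.walk = γ₂.1.walk := h1.symm.trans h2
  rcases γ₁ with ⟨⟨p, hp⟩, hp'⟩
  rcases γ₂ with ⟨⟨q, hq⟩, hq'⟩
  simp only at hw
  subst hw
  rfl

/-- (B): `Σ_{γ : t → b, b' ∈ γ} x_c^{|γ|} ≤ Z(t,b') · Z(b',b)` — the weight of `γ = α · β` is
`x_c^{|α|} · x_c^{|β|}`. -/
theorem tsum_through_le (t b b' : Site 2) :
    ∑' γ : {γ : DomainSAW Ω δ t b // b' ∈ γ.walk.support},
        ENNReal.ofReal (criticalFugacity ^ γ.1.length) ≤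
      SAW.weight Ω δ t b' univ * SAW.weight Ω δ b' b univ := by
  rw [weight_univ, weight_univ, ← ENNReal.tsum_mul_right]
  simp_rw [← ENNReal.tsum_mul_left]
  rw [← ENNReal.tsum_prod]
  -- the splitting map and its effect on the weight
  set s : {γ : DomainSAW Ω δ t b // b' ∈ γ.walk.support} → DomainSAW Ω δ t b' × DomainSAW Ω δ b' b :=
    fun γ => (⟨γ.1.walk.takeUntil b' γ.2, γ.1.isPath.takeUntil γ.2⟩,
      ⟨γ.1.walk.dropUntil b' γ.2, γ.1.isPath.dropUntil γ.2⟩) with hs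
  have hws : ∀ γ : {γ : DomainSAW Ω δ t b // b' ∈ γ.walk.support},
      ENNReal.ofReal (criticalFugacity ^ γ.1.length) =
        ENNReal.ofReal (criticalFugacity ^ (s γ).1.length) *
          ENNReal.ofReal (criticalFugacity ^ (s γ).2.length) := by
    intro γ
    have hl : (s γ).1.length + (s γ).2.length = γ.1.length := by
      have h := congrArg SimpleGraph.Walk.length (SimpleGraph.Walk.take_spec γ.1.walk γ.2)
      rw [SimpleGraph.Walk.length_append] at h
      exact h
    rw [← hl, pow_add, ENNReal.ofReal_mul (pow_nonneg criticalFugacity_pos_lt_one'.1.le _)]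
  calc ∑' γ : {γ : DomainSAW Ω δ t b // b' ∈ γ.walk.support},
          ENNReal.ofReal (criticalFugacity ^ γ.1.length)
      = ∑' γ : {γ : DomainSAW Ω δ t b // b' ∈ γ.walk.support},
          (fun p : DomainSAW Ω δ t b' × DomainSAW Ω δ b' b =>
            ENNReal.ofReal (criticalFugacity ^ p.1.length) *
              ENNReal.ofReal (criticalFugacity ^ p.2.length)) (s γ) := by
        congr 1; funext γ; exact hws γ
    _ ≤ ∑' p : DomainSAW Ω δ t b' × DomainSAW Ω δ b' b,
          ENNReal.ofReal (criticalFugacity ^ p.1.length) *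
            ENNReal.ofReal (criticalFugacity ^ p.2.length) :=
        ENNReal.tsum_comp_le_tsum_of_injective split_injective _

/-! ### The one-step comparison -/

/-- **One-step splitting bound** (hypothesis-free): for `b ∼ b'` adjacent in `Ω_δ` and every `t`,
`Z(t,b) ≤ (x_c⁻¹ + Z(b',b)) · Z(t,b')`. Valid for every `Ω ⊆ ℂ` and every real `δ`. -/
theorem weight_le_of_adj (Ω : Set ℂ) (δ : ℝ) (t b b' : Site 2)
    (h : (discreteDomainGraph Ω δ).Adj b b') :
    SAW.weight Ω δ t b univ ≤
      ((ENNReal.ofReal criticalFugacity)⁻¹ + SAW.weight Ω δ b' b univ) *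
        SAW.weight Ω δ t b' univ := by
  classical
  have hsplit : SAW.weight Ω δ t b univ =
      (∑' γ : {γ : DomainSAW Ω δ t b // b' ∉ γ.walk.support},
          ENNReal.ofReal (criticalFugacity ^ γ.1.length)) +
        ∑' γ : {γ : DomainSAW Ω δ t b // b' ∈ γ.walk.support},
          ENNReal.ofReal (criticalFugacity ^ γ.1.length) := by
    rw [weight_univ]
    have key := Summable.tsum_add_tsum_compl
      (f := fun γ : DomainSAW Ω δ t b => ENNReal.ofReal (criticalFugacity ^ γ.length))
      (s := {γ : DomainSAW Ω δ t b | b' ∈ γ.walk.support}) ENNReal.summable ENNReal.summable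
    calc ∑' γ : DomainSAW Ω δ t b, ENNReal.ofReal (criticalFugacity ^ γ.length)
        = (∑' γ : ↥{γ : DomainSAW Ω δ t b | b' ∈ γ.walk.support},
              ENNReal.ofReal (criticalFugacity ^ γ.1.length)) +
            ∑' γ : ↥({γ : DomainSAW Ω δ t b | b' ∈ γ.walk.support}ᶜ),
              ENNReal.ofReal (criticalFugacity ^ γ.1.length) := key.symm
      _ = (∑' γ : ↥({γ : DomainSAW Ω δ t b | b' ∈ γ.walk.support}ᶜ),
              ENNReal.ofReal (criticalFugacity ^ γ.1.length)) +
            ∑' γ : ↥{γ : DomainSAW Ω δ t b | b' ∈ γ.walk.support},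
              ENNReal.ofReal (criticalFugacity ^ γ.1.length) := add_comm _ _
      _ = _ := rfl
  rw [hsplit, add_mul]
  gcongr
  · exact tsum_avoid_le h
  · rw [mul_comm]
    exact tsum_through_le t b b'

end BoundaryHarnack

/-- **`CriticalBubbleBound → BoundaryHarnack`.** The tip-uniform boundary Harnack comparability
`Z(t,b) ≤ C · Z(t,b')` follows from the critical bubble bound ALONE, with `C = x_c⁻¹ + C_bubble`,
by the one-step splitting `BoundaryHarnack.weight_le_of_adj`; the interlacing and realisability
hypotheses, `Adj b c` and simple connectivity are idle. -/
theorem boundaryHarnack_of_criticalBubbleBound (hB : CriticalBubbleBound) : BoundaryHarnack := by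
  obtain ⟨C, hC, hbub⟩ := hB
  refine ⟨(ENNReal.ofReal criticalFugacity)⁻¹ + C,
    ENNReal.add_ne_top.mpr
      ⟨ENNReal.inv_ne_top.mpr BoundaryHarnack.ofReal_criticalFugacity_ne_zero, hC⟩, ?_⟩
  intro Ω δ t b b' c hΩ _ hδ hb'b _ _ _ _
  have hzd : (zdGraph 2).Adj b' b :=
    meshGraph_le_zdGraph Ω δ (discreteDomainGraph_le_meshGraph Ω δ hb'b)
  calc SAW.weight Ω δ t b univ
      ≤ ((ENNReal.ofReal criticalFugacity)⁻¹ + SAW.weight Ω δ b' b univ) *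
          SAW.weight Ω δ t b' univ :=
        BoundaryHarnack.weight_le_of_adj Ω δ t b b' hb'b.symm
    _ ≤ ((ENNReal.ofReal criticalFugacity)⁻¹ + C) * SAW.weight Ω δ t b' univ := by
        gcongr
        exact hbub Ω δ b' b hΩ hδ hzd

/-- **The glue decl `TPToHarnack` holds** (`BoundaryTP2 → CriticalBubbleBound → BoundaryHarnack`,
item stmt-CriticalPhenomena-7121 of the route): immediate from
`boundaryHarnack_of_criticalBubbleBound`, the hypothesis `BoundaryTP2` being unused. -/
theorem tpToHarnack_proof : TPToHarnack :=
  fun _ hB => boundaryHarnack_of_criticalBubbleBound hB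

end Summit.CriticalPhenomena.SAWScalingLimit.Theorems
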